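import Summits.CriticalPhenomena.PercolationContinuityZ3.Theorems.SahiMasterFamilyRigidityAllPrelim

/-!
# Rigidity at every order, sections: the `0`-section and the `1`-section of the multi-target identity (GI)

Support file of the master-family programme (crux `NoHeavyLowerTail`, stmt-CriticalPhenomena-4575; cell `prim-masterthm`, seat P4,
unit `prim-masterthm-p4-g8`).  Seat document HOME/prim-masterthm-p4/RIGIDITY-ALLK.md §1 (T3).  Second file.

For the identity `GI J V₀ V Q` (`Σ_j E(1_{V_j∩Q_j}) Π_{l≠j} E(1_{Q_l}) = E(1_{V₀}) Π_l E(1_{Q_l})` in `ℝ[X_ι]`) and a coordinate `x`: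
* `gi_sec1` — substituting `X_x ↦ 1` gives (GI) for the `1`-sections `(V₀^{x←1}; V_j^{x←1}, Q_j^{x←1})`;
* `gi_sec0` — the `0`-SECTION: voter `j` is replaced by its `0`-sections, EXCEPT when `Q_j` is frozen to `1` at `x` (`Q_j^{x←0} = ∅`), in which case
  by its `1`-sections (`bsec`); target `V₀^{x←0}`.  Proof: every frozen voter contributes a factor `X_x` to every term (`exPoly_ind_eq_X_mul`); cancel
  `X_x^{#frozen}` in the domain `ℝ[X_ι]`, then substitute `X_x ↦ 0`.
Also set-level bookkeeping for sections (`secAt_nonempty_iff`, `secAt_false_eq_empty_iff`, `insert_mem_secAt_iff_of_ne`, …).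
HONEST FRAMING: infrastructure; Sahi `C_k` / Kahn's Conj. 5 / the master theorem remain OPEN.  [this work]
-/

noncomputable section

open scoped Classical

namespace Summit.CriticalPhenomena.PercolationContinuityZ3.Theorems

open Finset Function MvPolynomial
open Literature.Combinatorics.Sahi2008
open Literature.Probability.Percolation.BHK2006 (weight)
open Literature.Probability.Percolation.DecisionTree (ind ind_of_mem ind_of_not_mem ind_nonneg)
open SharedCoordinate (Ignores xInd)
open ExpectationRigidity RigidityR3

namespace RigidityAll

variable {ι : Type*} [Fintype ι] {κ : Type*}

/-! ### Set-level facts about sections -/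

omit [Fintype ι] in
/-- Sections are monotone. [folklore] -/
theorem secAt_mono (x : ι) (b : Bool) {A B : Set (Set ι)} (h : A ⊆ B) : secAt x b A ⊆ secAt x b B :=
  fun _ hω => mem_secAt.2 (h (mem_secAt.1 hω))

omit [Fintype ι] in
/-- For an increasing event the `0`-section is contained in the `1`-section. [folklore] -/
theorem secAt_false_subset_secAt_true (x : ι) {A : Set (Set ι)} (hA : IsUpperSet A) : secAt x false A ⊆ secAt x true A := by
  intro ω hω
  rw [mem_secAt] at hω ⊢
  simp only [forceAt, cond_true, cond_false] at hω ⊢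
  exact hA (Set.sdiff_subset.trans (Set.subset_insert x ω)) hω

omit [Fintype ι] in
/-- Forcing `x` commutes with inserting `y ≠ x`. [folklore] -/
theorem forceAt_insert_of_ne {x y : ι} (hxy : y ≠ x) (b : Bool) (ω : Set ι) :
    forceAt x b (insert y ω) = insert y (forceAt x b ω) := by
  cases b
  · simp only [forceAt, cond_false]
    ext i
    simp only [Set.mem_sdiff, Set.mem_insert_iff, Set.mem_singleton_iff]
    constructor
    · rintro ⟨h | h, hi⟩
      · exact Or.inl h
      · exact Or.inr ⟨h, hi⟩
    · rintro (h | ⟨h, hi⟩)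
      · exact ⟨Or.inl h, fun hix => hxy (h ▸ hix)⟩
      · exact ⟨Or.inr h, hi⟩
  · simp only [forceAt, cond_true]
    exact Set.insert_comm x y ω

omit [Fintype ι] in
/-- A section of a `y`-free event (`y ≠ x`) is `y`-free. [folklore] -/
theorem insert_mem_secAt_iff_of_ne {x y : ι} (hxy : y ≠ x) (b : Bool) {A : Set (Set ι)} (hA : ∀ ω, insert y ω ∈ A ↔ ω ∈ A)
    (ω : Set ι) : insert y ω ∈ secAt x b A ↔ ω ∈ secAt x b A := by
  rw [mem_secAt, mem_secAt, forceAt_insert_of_ne hxy, hA]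

omit [Fintype ι] in
/-- A section is nonempty iff the event has an element with the right `x`-status. [folklore] -/
theorem secAt_nonempty_iff (x : ι) (b : Bool) (A : Set (Set ι)) : (secAt x b A).Nonempty ↔ ∃ ω ∈ A, (x ∈ ω ↔ b = true) := by
  constructor
  · rintro ⟨ω, hω⟩
    refine ⟨forceAt x b ω, mem_secAt.1 hω, ?_⟩
    cases b <;> simp [forceAt]
  · rintro ⟨ω, hω, hx⟩
    exact ⟨ω, mem_secAt.2 (by rwa [forceAt_of_iff hx])⟩

omit [Fintype ι] in
/-- `A^{x←0} = ∅` iff every element of `A` contains `x` (`A` is frozen to `1` at `x`). [folklore] -/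
theorem secAt_false_eq_empty_iff (x : ι) (A : Set (Set ι)) : secAt x false A = ∅ ↔ ∀ ω ∈ A, x ∈ ω := by
  rw [← Set.not_nonempty_iff_eq_empty, secAt_nonempty_iff]
  push Not
  exact forall₂_congr fun ω _ => by simp

omit [Fintype ι] in
/-- `A^{x←1} = ∅` iff no element of `A` contains `x` (`A` is frozen to `0` at `x`). [folklore] -/
theorem secAt_true_eq_empty_iff (x : ι) (A : Set (Set ι)) : secAt x true A = ∅ ↔ ∀ ω ∈ A, x ∉ ω := by
  rw [← Set.not_nonempty_iff_eq_empty, secAt_nonempty_iff]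
  push Not
  exact forall₂_congr fun ω _ => by simp

omit [Fintype ι] in
/-- An element of `A` with the right `x`-status lies in the section. [folklore] -/
theorem mem_secAt_of_mem {x : ι} {b : Bool} {A : Set (Set ι)} {ω : Set ι} (hω : ω ∈ A) (hx : x ∈ ω ↔ b = true) : ω ∈ secAt x b A :=
  mem_secAt.2 (by rwa [forceAt_of_iff hx])

/-! ### The sections of (GI) -/

/-- The section bit of voter `j` at `x` for the `0`-section: `true` (use the `1`-sections) iff `Q_j` is frozen to `1` at `x`. [this work] -/
def bsec (x : ι) (A : Set (Set ι)) : Bool := if secAt x false A = ∅ then true else false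

omit [Fintype ι] in
/-- `bsec` of an event not frozen to `1`. [this work] -/
theorem bsec_of_ne {x : ι} {A : Set (Set ι)} (h : secAt x false A ≠ ∅) : bsec x A = false := by
  simp only [bsec, if_neg h]

omit [Fintype ι] in
/-- `bsec` of an event frozen to `1`. [this work] -/
theorem bsec_of_eq {x : ι} {A : Set (Set ι)} (h : secAt x false A = ∅) : bsec x A = true := by
  simp only [bsec, if_pos h]

/-- **The `1`-section of (GI).** [this work] -/
theorem gi_sec1 {J : Finset κ} {V₀ : Set (Set ι)} {V Q : κ → Set (Set ι)} (h : GI J V₀ V Q) (x : ι) :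
    GI J (secAt x true V₀) (fun j => secAt x true (V j)) (fun j => secAt x true (Q j)) := by
  unfold GI at h ⊢
  have h1 := congrArg (substAt x 1) h
  simp only [map_sum, map_mul, map_prod, substAt_one_exPoly, ← ind_secAt, secAt_inter] at h1
  exact h1

/-- **The `0`-section of (GI)** (frozen-to-`1` voters pass to their `1`-sections, all others and the target to their `0`-sections). [this work] -/
theorem gi_sec0 {J : Finset κ} {V₀ : Set (Set ι)} {V Q : κ → Set (Set ι)} (h : GI J V₀ V Q) (x : ι) :
    GI J (secAt x false V₀) (fun j => secAt x (bsec x (Q j)) (V j)) (fun j => secAt x (bsec x (Q j)) (Q j)) := by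
  unfold GI at h ⊢
  -- normal forms `E(1_Q) = X_x^{e} · G`, `E(1_{V∩Q}) = X_x^{e} · NG`
  set e : κ → ℕ := fun l => if secAt x false (Q l) = ∅ then 1 else 0 with he
  set G : κ → MvPolynomial ι ℝ := fun l =>
    if secAt x false (Q l) = ∅ then exPoly (ind (secAt x true (Q l))) else exPoly (ind (Q l)) with hG
  set NG : κ → MvPolynomial ι ℝ := fun l =>
    if secAt x false (Q l) = ∅ then exPoly (ind (secAt x true (V l ∩ Q l))) else exPoly (ind (V l ∩ Q l)) with hNG
  have hD : ∀ l, exPoly (ind (Q l)) = X x ^ e l * G l := by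
    intro l
    by_cases hf : secAt x false (Q l) = ∅
    · simp only [he, hG, if_pos hf, pow_one]; exact exPoly_ind_eq_X_mul hf
    · simp only [he, hG, if_neg hf, pow_zero, one_mul]
  have hN : ∀ l, exPoly (ind (V l ∩ Q l)) = X x ^ e l * NG l := by
    intro l
    by_cases hf : secAt x false (Q l) = ∅
    · simp only [he, hNG, if_pos hf, pow_one]; exact exPoly_ind_eq_X_mul (secAt_false_inter_eq_empty hf)
    · simp only [he, hNG, if_neg hf, pow_zero, one_mul]
  have hprod : ∀ T : Finset κ, ∏ l ∈ T, exPoly (ind (Q l)) = X x ^ (∑ l ∈ T, e l) * ∏ l ∈ T, G l := by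
    intro T
    rw [prod_congr rfl fun l _ => hD l, prod_mul_distrib, prod_pow_eq_pow_sum]
  rw [hprod J, sum_congr rfl fun j _ => by rw [hN j, hprod (J.erase j)]] at h
  -- factor out `X_x^{Σ e}` and cancel it
  have h2 : X x ^ (∑ l ∈ J, e l) * (∑ j ∈ J, NG j * ∏ l ∈ J.erase j, G l) =
      X x ^ (∑ l ∈ J, e l) * (exPoly (ind V₀) * ∏ l ∈ J, G l) := by
    rw [mul_sum]
    convert h using 1
    · refine sum_congr rfl fun j hj => ?_
      rw [← add_sum_erase J e hj, pow_add]
      ring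
    · ring
  have hX : X x ^ (∑ l ∈ J, e l) ≠ (0 : MvPolynomial ι ℝ) := pow_ne_zero _ (X_ne_zero x)
  have h3 := mul_left_cancel₀ hX h2
  -- substitute `X_x ↦ 0`
  have h4 := congrArg (substAt x 0) h3
  simp only [map_sum, map_mul, map_prod] at h4
  have hGs : ∀ l, substAt x 0 (G l) = exPoly (ind (secAt x (bsec x (Q l)) (Q l))) := by
    intro l
    by_cases hf : secAt x false (Q l) = ∅
    · simp only [hG, if_pos hf, bsec_of_eq hf]; exact substAt_exPoly_ind_secAt x 0 true (Q l)
    · simp only [hG, if_neg hf, bsec_of_ne hf]; rw [substAt_zero_exPoly, ← ind_secAt]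
  have hNGs : ∀ l, substAt x 0 (NG l) = exPoly (ind (secAt x (bsec x (Q l)) (V l) ∩ secAt x (bsec x (Q l)) (Q l))) := by
    intro l
    by_cases hf : secAt x false (Q l) = ∅
    · simp only [hNG, if_pos hf, bsec_of_eq hf]; rw [← secAt_inter]; exact substAt_exPoly_ind_secAt x 0 true _
    · simp only [hNG, if_neg hf, bsec_of_ne hf]; rw [substAt_zero_exPoly, ← ind_secAt, secAt_inter]
  have hV₀ : substAt x 0 (exPoly (ind V₀)) = exPoly (ind (secAt x false V₀)) := by rw [substAt_zero_exPoly, ← ind_secAt]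
  simp only [hGs, hNGs, hV₀] at h4
  exact h4

end RigidityAll

end Summit.CriticalPhenomena.PercolationContinuityZ3.Theorems
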